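import Summits.ValiantsHypothesis.ValiantsHypothesis.Theorems.LacunarySymmetroidMatrixDescartesLagrangeMirrorAlternation
import Summits.ValiantsHypothesis.ValiantsHypothesis.Theorems.LacunarySymmetroidMatrixDescartesLagrangeTowerFrame

/-!
# `MatrixDescartes` census — two-sided (mirror) Lagrange tower: kernel frame and `Gen.step_good` for either orientation

HONEST FRAMING.  Object-search cell `pub-symmetroid`, crux `Theses.LacunarySymmetroid.MatrixDescartes`
(stmt-ValiantsHypothesis-18050); seat val-sym-mdr-p1 (g2).  Part of the kernel port of the cell's TWO-SIDED Lagrange tower P4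
(conjb-3 g4, ROUND4-MEMO §2) in the seat's arrowhead form (`…LagrangeMirrorDefs`): for EVERY `m ≥ 1` some real symmetric FOUR-term
lacunary `m × m` pencil has `m² + 2m` distinct positive determinant roots (`¬ PosRootLawAt m 4 ((m+1)² − 2)`).  A LOWER-bound /
construction statement in census (CONJECTURE-A) currency for the `K = 4` column; it proves nothing about the crux `MatrixDescartes`
(an upper-bound statement at fat formats), nothing about the cubic-vs-quadratic fork beyond this floor, and nothing about `VP ≠ VNP`.
No definitions in this file.

THIS FILE. Explicit kernel vectors of the general arrowhead, their `Bflat`-orthogonality, `Vflatᵀ (Aflat + x Bflat) Vflat = diagonal`, transport through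
`W ⊕ 1`, and `Gen.step_good : d.GoodAt ν → … → (Gen.step ν z s d).GoodAt z`. [folklore]
-/

-- `Summit.ValiantsHypothesis.ValiantsHypothesis.…` repeats a component by the D-0017 layout
-- (single-conjunct summit), which the `dupNamespace` linter flags; the name is mandated.
set_option linter.dupNamespace false

namespace Summit.ValiantsHypothesis.ValiantsHypothesis.Theorems.LacunarySymmetroidMatrixDescartes.Census.LagrangeTower

open Matrix Polynomial Finset
open scoped BigOperators

namespace Gen

section Frame

variable {k : ℕ} (ν : Fin k → ℝ) (z : Fin (k + 1) → ℝ) (s : ℝ) (d : TowerData k)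

/-- The arrowhead constant letter is symmetric. -/
theorem Aflat_isSymm : (Aflat ν z s d).IsSymm := by
  unfold Matrix.IsSymm Aflat
  rw [Matrix.fromBlocks_transpose, Matrix.diagonal_transpose, Matrix.transpose_replicateCol,
    Matrix.transpose_replicateRow]
  congr 1

/-- The arrowhead linear letter is symmetric. -/
theorem Bflat_isSymm : (Bflat ν z s d).IsSymm := by
  unfold Matrix.IsSymm Bflat
  rw [Matrix.fromBlocks_transpose, Matrix.diagonal_transpose, Matrix.transpose_zero, Matrix.transpose_zero]
  congr 1

/-- **Kernel vectors**: `(Aflat + z_i • Bflat) · v_i = 0`. -/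
theorem flat_mulVec_kvec (halt : ∀ l : Fin k, 0 < d.θ * (-1) ^ (l : ℕ) * d.β l) (hν : StrictMono ν)
    (hν5 : ∀ l, ν l < 5) (hsep : (s = 1 ∧ ∀ i l, z i < ν l) ∨ (s = -1 ∧ ∀ i l, ν l < z i))
    (i : Fin (k + 1)) :
    (Aflat ν z s d + z i • Bflat ν z s d) *ᵥ kvec ν z s d i = 0 := by
  have hψ := ψfun_root ν z s d halt hν hν5 hsep i
  unfold Aflat Bflat kvec
  rw [Matrix.fromBlocks_smul, Matrix.fromBlocks_add, Matrix.fromBlocks_mulVec]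
  funext p
  rcases p with l | u
  · simp only [Sum.elim_inl, Pi.add_apply, smul_zero, add_zero, Pi.zero_apply]
    have hβ := β_ne_zero d halt l
    have hz : z i - ν l ≠ 0 := sub_ne_zero.mpr (z_ne_ν ν z hsep i l)
    rw [show (Sum.elim (fun l => -cvec ν z s d l / (d.β l * (z i - ν l))) (fun _ => (1 : ℝ))) ∘ Sum.inl
        = fun l => -cvec ν z s d l / (d.β l * (z i - ν l)) from rfl,
      show (Sum.elim (fun l => -cvec ν z s d l / (d.β l * (z i - ν l))) (fun _ => (1 : ℝ))) ∘ Sum.inr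
        = fun _ => (1 : ℝ) from rfl]
    rw [← Matrix.diagonal_smul, Matrix.diagonal_add, Matrix.mulVec_diagonal]
    simp only [Matrix.mulVec, dotProduct, Matrix.replicateCol_apply, Fin.sum_univ_one, mul_one, Pi.smul_apply,
      smul_eq_mul]
    field_simp
    ring
  · simp only [Sum.elim_inr, Pi.add_apply, Pi.zero_apply]
    rw [show (Sum.elim (fun l => -cvec ν z s d l / (d.β l * (z i - ν l))) (fun _ => (1 : ℝ))) ∘ Sum.inl
        = fun l => -cvec ν z s d l / (d.β l * (z i - ν l)) from rfl,
      show (Sum.elim (fun l => -cvec ν z s d l / (d.β l * (z i - ν l))) (fun _ => (1 : ℝ))) ∘ Sum.inr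
        = fun _ => (1 : ℝ) from rfl]
    simp only [Matrix.mulVec, dotProduct, Matrix.replicateRow_apply, Matrix.add_apply, Matrix.smul_apply,
      Matrix.of_apply, Matrix.zero_apply, smul_eq_mul, mul_zero, add_zero, Fin.sum_univ_one, mul_one]
    unfold ψfun at hψ
    rw [eval_Lpoly] at hψ
    have hβ := fun l => β_ne_zero d halt l
    have : ∑ x, cvec ν z s d x * (-cvec ν z s d x / (d.β x * (z i - ν x)))
        = -∑ l, cvec ν z s d l ^ 2 / d.β l / (z i - ν l) := by
      rw [← Finset.sum_neg_distrib]
      refine Finset.sum_congr rfl fun l _ => ?_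
      have hz : z i - ν l ≠ 0 := sub_ne_zero.mpr (z_ne_ν ν z hsep i l)
      field_simp
    rw [this]
    linear_combination hψ

/-- `v_i ⬝ (Bflat v_j) = 0` for `i ≠ j` (symmetry + distinct parent roots). -/
theorem kvec_B_kvec_offdiag (halt : ∀ l : Fin k, 0 < d.θ * (-1) ^ (l : ℕ) * d.β l) (hν : StrictMono ν)
    (hz : StrictMono z) (hν5 : ∀ l, ν l < 5) (hsep : (s = 1 ∧ ∀ i l, z i < ν l) ∨ (s = -1 ∧ ∀ i l, ν l < z i))
    {i j : Fin (k + 1)} (hij : i ≠ j) :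
    kvec ν z s d i ⬝ᵥ (Bflat ν z s d *ᵥ kvec ν z s d j) = 0 := by
  have hi := flat_mulVec_kvec ν z s d halt hν hν5 hsep i
  have hj := flat_mulVec_kvec ν z s d halt hν hν5 hsep j
  have hsymm : (Aflat ν z s d + z i • Bflat ν z s d).IsSymm := by
    unfold Matrix.IsSymm
    rw [Matrix.transpose_add, Matrix.transpose_smul, Aflat_isSymm, Bflat_isSymm]
  have h1 : kvec ν z s d j ⬝ᵥ ((Aflat ν z s d + z i • Bflat ν z s d) *ᵥ kvec ν z s d i) = 0 := by
    rw [hi, dotProduct_zero]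
  rw [dotProduct_mulVec_symm hsymm] at h1
  have h2 : (Aflat ν z s d + z i • Bflat ν z s d)
      = (Aflat ν z s d + z j • Bflat ν z s d) + (z i - z j) • Bflat ν z s d := by
    rw [sub_smul]; abel
  rw [h2, Matrix.add_mulVec, dotProduct_add, hj, dotProduct_zero, zero_add, Matrix.smul_mulVec,
    dotProduct_smul, smul_eq_mul] at h1
  have hzz : z i - z j ≠ 0 := sub_ne_zero.mpr fun h => hij (hz.injective h)
  exact (mul_eq_zero.mp h1).resolve_left hzz

/-- `Bflat · v_i`, explicitly. -/
theorem Bflat_mulVec_kvec (i : Fin (k + 1)) :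
    Bflat ν z s d *ᵥ kvec ν z s d i
      = Sum.elim (fun l => d.β l * (-cvec ν z s d l / (d.β l * (z i - ν l)))) (fun _ => ηnew s d * lslope ν z) := by
  unfold Bflat kvec
  rw [Matrix.fromBlocks_mulVec]
  funext p
  rcases p with l | u
  · simp only [Sum.elim_inl, Matrix.zero_mulVec, add_zero]
    rw [show (Sum.elim (fun l => -cvec ν z s d l / (d.β l * (z i - ν l))) (fun _ => (1 : ℝ))) ∘ Sum.inl
        = fun l => -cvec ν z s d l / (d.β l * (z i - ν l)) from rfl, Matrix.mulVec_diagonal]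
  · simp only [Sum.elim_inr, Matrix.zero_mulVec, zero_add]
    rw [show (Sum.elim (fun l => -cvec ν z s d l / (d.β l * (z i - ν l))) (fun _ => (1 : ℝ))) ∘ Sum.inr
        = fun _ => (1 : ℝ) from rfl]
    simp only [Matrix.mulVec, dotProduct, Matrix.of_apply, Fin.sum_univ_one, mul_one]

/-- `v_i ⬝ (Bflat v_i) = βnew i`. -/
theorem kvec_B_kvec_diag (halt : ∀ l : Fin k, 0 < d.θ * (-1) ^ (l : ℕ) * d.β l)
    (hsep : (s = 1 ∧ ∀ i l, z i < ν l) ∨ (s = -1 ∧ ∀ i l, ν l < z i)) (i : Fin (k + 1)) :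
    kvec ν z s d i ⬝ᵥ (Bflat ν z s d *ᵥ kvec ν z s d i) = βnew ν z s d i := by
  rw [Bflat_mulVec_kvec]
  unfold kvec βnew ψder
  rw [sumElim_dotProduct_sumElim]
  simp only [dotProduct, Fin.sum_univ_one, one_mul]
  rw [add_comm]
  congr 1
  refine Finset.sum_congr rfl fun l _ => ?_
  have hβ := β_ne_zero d halt l
  have hz : z i - ν l ≠ 0 := sub_ne_zero.mpr (z_ne_ν ν z hsep i l)
  field_simp

/-- `v_i ⬝ (Aflat v_j) = −z_j · v_i ⬝ (Bflat v_j)`. -/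
theorem kvec_A_kvec (halt : ∀ l : Fin k, 0 < d.θ * (-1) ^ (l : ℕ) * d.β l) (hν : StrictMono ν)
    (hν5 : ∀ l, ν l < 5) (hsep : (s = 1 ∧ ∀ i l, z i < ν l) ∨ (s = -1 ∧ ∀ i l, ν l < z i))
    (i j : Fin (k + 1)) :
    kvec ν z s d i ⬝ᵥ (Aflat ν z s d *ᵥ kvec ν z s d j)
      = -(z j * (kvec ν z s d i ⬝ᵥ (Bflat ν z s d *ᵥ kvec ν z s d j))) := by
  have hj := flat_mulVec_kvec ν z s d halt hν hν5 hsep j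
  rw [Matrix.add_mulVec, Matrix.smul_mulVec] at hj
  have : Aflat ν z s d *ᵥ kvec ν z s d j = -(z j • (Bflat ν z s d *ᵥ kvec ν z s d j)) :=
    eq_neg_of_add_eq_zero_left hj
  rw [this, dotProduct_neg, dotProduct_smul, smul_eq_mul]

/-- **The kernel frame diagonalises the arrowhead**: `Vflatᵀ Bflat Vflat = diagonal βnew`. -/
theorem Vflat_B_Vflat (halt : ∀ l : Fin k, 0 < d.θ * (-1) ^ (l : ℕ) * d.β l) (hν : StrictMono ν)
    (hz : StrictMono z) (hν5 : ∀ l, ν l < 5) (hsep : (s = 1 ∧ ∀ i l, z i < ν l) ∨ (s = -1 ∧ ∀ i l, ν l < z i)) :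
    (Vflat ν z s d)ᵀ * Bflat ν z s d * Vflat ν z s d = diagonal (βnew ν z s d) := by
  ext i j
  rw [transpose_mul_mul_apply]
  change kvec ν z s d i ⬝ᵥ (Bflat ν z s d *ᵥ kvec ν z s d j) = _
  by_cases hij : i = j
  · subst hij; rw [Matrix.diagonal_apply_eq, kvec_B_kvec_diag ν z s d halt hsep]
  · rw [Matrix.diagonal_apply_ne _ hij, kvec_B_kvec_offdiag ν z s d halt hν hz hν5 hsep hij]

/-- `Vflatᵀ Aflat Vflat = diagonal (−βnew·z)`. -/
theorem Vflat_A_Vflat (halt : ∀ l : Fin k, 0 < d.θ * (-1) ^ (l : ℕ) * d.β l) (hν : StrictMono ν)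
    (hz : StrictMono z) (hν5 : ∀ l, ν l < 5) (hsep : (s = 1 ∧ ∀ i l, z i < ν l) ∨ (s = -1 ∧ ∀ i l, ν l < z i)) :
    (Vflat ν z s d)ᵀ * Aflat ν z s d * Vflat ν z s d = diagonal (fun i => -(βnew ν z s d i * z i)) := by
  ext i j
  rw [transpose_mul_mul_apply]
  change kvec ν z s d i ⬝ᵥ (Aflat ν z s d *ᵥ kvec ν z s d j) = _
  rw [kvec_A_kvec ν z s d halt hν hν5 hsep]
  by_cases hij : i = j
  · subst hij; rw [Matrix.diagonal_apply_eq, kvec_B_kvec_diag ν z s d halt hsep]; ring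
  · rw [Matrix.diagonal_apply_ne _ hij, kvec_B_kvec_offdiag ν z s d halt hν hz hν5 hsep hij]; ring

/-- In Sum coordinates the arrowhead pencil is diagonalised with the designed parent roots. -/
theorem Vflat_pencil_Vflat (halt : ∀ l : Fin k, 0 < d.θ * (-1) ^ (l : ℕ) * d.β l) (hν : StrictMono ν)
    (hz : StrictMono z) (hν5 : ∀ l, ν l < 5) (hsep : (s = 1 ∧ ∀ i l, z i < ν l) ∨ (s = -1 ∧ ∀ i l, ν l < z i))
    (x : ℝ) :
    (Vflat ν z s d)ᵀ * (Aflat ν z s d + x • Bflat ν z s d) * Vflat ν z s d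
      = diagonal (fun i => βnew ν z s d i * (x - z i)) := by
  rw [Matrix.mul_add, Matrix.add_mul, Matrix.mul_smul, Matrix.smul_mul, Vflat_A_Vflat ν z s d halt hν hz hν5 hsep,
    Vflat_B_Vflat ν z s d halt hν hz hν5 hsep, ← Matrix.diagonal_smul, Matrix.diagonal_add]
  congr 1
  funext i
  simp only [Pi.smul_apply, smul_eq_mul]
  ring

end Frame

section StepGood

variable {k : ℕ} (ν : Fin k → ℝ) (z : Fin (k + 1) → ℝ) (s : ℝ) (d : TowerData k)

/-- On a good level with roots `ν`, `Wᵀ A W = diagonal (−β·ν)`. -/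
theorem W_A_W (hd : d.GoodAt ν) : d.Wᵀ * d.A * d.W = diagonal (fun l => -(d.β l * ν l)) := by
  have h := hd.2.2.1 0
  rw [zero_smul, add_zero] at h
  rw [h]
  congr 1; funext l; ring

/-- On a good level, `Wᵀ B W = diagonal β`. -/
theorem W_B_W (hd : d.GoodAt ν) : d.Wᵀ * d.B * d.W = diagonal d.β := by
  have h0 := hd.2.2.1 0
  have h1 := hd.2.2.1 1
  rw [zero_smul, add_zero] at h0
  rw [one_smul, Matrix.mul_add, Matrix.add_mul, h0] at h1
  have : d.Wᵀ * d.B * d.W = diagonal (fun i => d.β i * (1 - ν i)) - diagonal (fun i => d.β i * (0 - ν i)) :=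
    eq_sub_of_add_eq' h1
  rw [this, Matrix.diagonal_sub]
  congr 1; funext l; ring

/-- Conjugating the bordered constant letter by `W ⊕ 1` gives the arrowhead letter `Aflat`. -/
theorem stepA_conj (hd : d.GoodAt ν) :
    (extendOne d.W)ᵀ * (step ν z s d).A * extendOne d.W
      = Matrix.reindex (finSumFinEquiv : Fin k ⊕ Fin 1 ≃ Fin (k + 1)) finSumFinEquiv (Aflat ν z s d) := by
  rw [transpose_extendOne]
  unfold extendOne
  change Matrix.reindex _ _ _ * Matrix.reindex finSumFinEquiv finSumFinEquiv
      (Matrix.fromBlocks d.A (replicateCol (Fin 1) (bvec ν z s d)) (replicateRow (Fin 1) (bvec ν z s d))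
        (Matrix.of fun _ _ => ηnew s d * lconst ν z)) * _ = _
  rw [reindex_mul_reindex, reindex_mul_reindex]
  congr 1
  rw [Matrix.fromBlocks_multiply, Matrix.fromBlocks_multiply]
  simp only [Matrix.zero_mul, Matrix.mul_zero, add_zero, zero_add, Matrix.one_mul, Matrix.mul_one]
  unfold Aflat
  have hWU : d.Wᵀ * d.U = 1 := hd.2.1
  have hcol : d.Wᵀ * replicateCol (Fin 1) (bvec ν z s d) = replicateCol (Fin 1) (cvec ν z s d) := by
    unfold bvec
    rw [← Matrix.replicateCol_mulVec, Matrix.mulVec_mulVec, hWU, Matrix.one_mulVec]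
  have hrow : replicateRow (Fin 1) (bvec ν z s d) * d.W = replicateRow (Fin 1) (cvec ν z s d) := by
    unfold bvec
    rw [← Matrix.replicateRow_vecMul, ← Matrix.mulVec_transpose, Matrix.mulVec_mulVec, hWU, Matrix.one_mulVec]
  rw [W_A_W ν d hd, hcol, hrow]

/-- Conjugating the bordered linear letter by `W ⊕ 1` gives the arrowhead letter `Bflat`. -/
theorem stepB_conj (hd : d.GoodAt ν) :
    (extendOne d.W)ᵀ * (step ν z s d).B * extendOne d.W
      = Matrix.reindex (finSumFinEquiv : Fin k ⊕ Fin 1 ≃ Fin (k + 1)) finSumFinEquiv (Bflat ν z s d) := by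
  rw [transpose_extendOne]
  unfold extendOne
  change Matrix.reindex _ _ _ * Matrix.reindex finSumFinEquiv finSumFinEquiv
      (Matrix.fromBlocks d.B 0 0 (Matrix.of fun _ _ => ηnew s d * lslope ν z)) * _ = _
  rw [reindex_mul_reindex, reindex_mul_reindex]
  congr 1
  rw [Matrix.fromBlocks_multiply, Matrix.fromBlocks_multiply]
  simp only [Matrix.zero_mul, Matrix.mul_zero, add_zero, zero_add, Matrix.one_mul, Matrix.mul_one]
  unfold Bflat
  rw [W_B_W ν d hd]

/-- Un-reindexing the frame: `Vsqᵀ (reindex M) Vsq = Vflatᵀ M Vflat`. -/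
theorem Vsq_conj (M : Matrix (Fin k ⊕ Fin 1) (Fin k ⊕ Fin 1) ℝ) :
    (Vsq ν z s d)ᵀ * Matrix.reindex (finSumFinEquiv : Fin k ⊕ Fin 1 ≃ Fin (k + 1)) finSumFinEquiv M * Vsq ν z s d
      = (Vflat ν z s d)ᵀ * M * Vflat ν z s d := by
  unfold Vsq
  rw [Matrix.transpose_submatrix, Matrix.reindex_apply, Matrix.submatrix_mul_equiv, Matrix.submatrix_mul_equiv,
    Matrix.submatrix_id_id]

/-- `W_newᵀ = Vsqᵀ (W ⊕ 1)ᵀ`. -/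
theorem step_W_transpose : (step ν z s d).Wᵀ = (Vsq ν z s d)ᵀ * (extendOne d.W)ᵀ := by
  change (extendOne d.W * Vsq ν z s d)ᵀ = _
  rw [Matrix.transpose_mul]

/-- **The new frame diagonalises the bordered pencil with the designed parent roots.** -/
theorem step_hdiag (hd : d.GoodAt ν) (hν : StrictMono ν) (hz : StrictMono z) (hν5 : ∀ l, ν l < 5)
    (hsep : (s = 1 ∧ ∀ i l, z i < ν l) ∨ (s = -1 ∧ ∀ i l, ν l < z i)) (x : ℝ) :
    (step ν z s d).Wᵀ * ((step ν z s d).A + x • (step ν z s d).B) * (step ν z s d).W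
      = diagonal (fun i => (step ν z s d).β i * (x - z i)) := by
  rw [step_W_transpose]
  change (Vsq ν z s d)ᵀ * (extendOne d.W)ᵀ * ((step ν z s d).A + x • (step ν z s d).B) * (extendOne d.W * Vsq ν z s d)
      = diagonal (fun i => βnew ν z s d i * (x - z i))
  have hA := stepA_conj ν z s d hd
  have hB := stepB_conj ν z s d hd
  have : (Vsq ν z s d)ᵀ * (extendOne d.W)ᵀ * ((step ν z s d).A + x • (step ν z s d).B) * (extendOne d.W * Vsq ν z s d)
      = (Vsq ν z s d)ᵀ * Matrix.reindex (finSumFinEquiv : Fin k ⊕ Fin 1 ≃ Fin (k + 1)) finSumFinEquiv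
          (Aflat ν z s d + x • Bflat ν z s d) * Vsq ν z s d := by
    rw [reindex_add_smul, ← hA, ← hB]
    simp only [Matrix.mul_add, Matrix.add_mul, Matrix.mul_smul, Matrix.smul_mul, Matrix.mul_assoc]
  rw [this, Vsq_conj, Vflat_pencil_Vflat ν z s d hd.2.2.2 hν hz hν5 hsep]

/-- **`Wᵀ U = 1` for the new level.** -/
theorem step_hWU (hd : d.GoodAt ν) (hν : StrictMono ν) (hz : StrictMono z) (hν5 : ∀ l, ν l < 5)
    (hsep : (s = 1 ∧ ∀ i l, z i < ν l) ∨ (s = -1 ∧ ∀ i l, ν l < z i)) :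
    (step ν z s d).Wᵀ * (step ν z s d).U = 1 := by
  rw [step_W_transpose]
  change (Vsq ν z s d)ᵀ * (extendOne d.W)ᵀ *
      (extendOne d.U * Matrix.reindex finSumFinEquiv finSumFinEquiv (Bflat ν z s d) * Vsq ν z s d *
        diagonal (fun i => (βnew ν z s d i)⁻¹)) = 1
  have hWU : (extendOne d.W)ᵀ * extendOne d.U = 1 := by
    rw [transpose_extendOne]
    unfold extendOne
    rw [reindex_mul_reindex, Matrix.fromBlocks_multiply]
    simp only [Matrix.zero_mul, Matrix.mul_zero, add_zero, zero_add, Matrix.mul_one, hd.2.1,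
      Matrix.fromBlocks_one]
    simp [Matrix.reindex_apply]
  have hβ : ∀ i, βnew ν z s d i ≠ 0 := by
    intro i h
    have := βnew_alt ν z s d hd.2.2.2 hd.1 hν hz hν5 hsep i
    rw [h, mul_zero] at this
    exact lt_irrefl _ this
  calc (Vsq ν z s d)ᵀ * (extendOne d.W)ᵀ *
      (extendOne d.U * Matrix.reindex finSumFinEquiv finSumFinEquiv (Bflat ν z s d) * Vsq ν z s d *
        diagonal (fun i => (βnew ν z s d i)⁻¹))
      = (Vsq ν z s d)ᵀ * (((extendOne d.W)ᵀ * extendOne d.U) *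
          Matrix.reindex finSumFinEquiv finSumFinEquiv (Bflat ν z s d)) * Vsq ν z s d *
          diagonal (fun i => (βnew ν z s d i)⁻¹) := by
        simp only [Matrix.mul_assoc]
    _ = ((Vsq ν z s d)ᵀ * Matrix.reindex finSumFinEquiv finSumFinEquiv (Bflat ν z s d) * Vsq ν z s d) *
          diagonal (fun i => (βnew ν z s d i)⁻¹) := by rw [hWU, Matrix.one_mul]
    _ = diagonal (βnew ν z s d) * diagonal (fun i => (βnew ν z s d i)⁻¹) := by
        rw [Vsq_conj, Vflat_B_Vflat ν z s d hd.2.2.2 hν hz hν5 hsep]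
    _ = 1 := by
        rw [Matrix.diagonal_mul_diagonal, ← Matrix.diagonal_one]
        congr 1; funext i; exact mul_inv_cancel₀ (hβ i)

/-- **THE GENERAL BORDERING STEP PRESERVES THE SPLIT-FRAME IDENTITIES** (parent roots `z`, on either side of the child). -/
theorem step_good (hd : d.GoodAt ν) (hν : StrictMono ν) (hz : StrictMono z) (hν5 : ∀ l, ν l < 5)
    (hsep : (s = 1 ∧ ∀ i l, z i < ν l) ∨ (s = -1 ∧ ∀ i l, ν l < z i)) : (step ν z s d).GoodAt z := by
  refine ⟨θnew_cases s d hd.1 (s_cases ν z hsep), step_hWU ν z s d hd hν hz hν5 hsep,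
    step_hdiag ν z s d hd hν hz hν5 hsep, ?_⟩
  intro i
  exact βnew_alt ν z s d hd.2.2.2 hd.1 hν hz hν5 hsep i

end StepGood

end Gen

end Summit.ValiantsHypothesis.ValiantsHypothesis.Theorems.LacunarySymmetroidMatrixDescartes.Census.LagrangeTower
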